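import Mathlib
import Summits.ResolutionOfSingularities.ResolutionOfSingularities.Theorems.WeightedInvariantLocalWeightedDropWildMonicCleanRep
import Summits.ResolutionOfSingularities.ResolutionOfSingularities.Theorems.WeightedInvariantLocalWeightedDropWildMonicSCleanProcess
import Summits.ResolutionOfSingularities.ResolutionOfSingularities.Theorems.WeightedInvariantLocalWeightedDropWildMonicFlagAttainRecentreMax

/-!
# `WeightedInvariant.LocalWeightedDrop`, line `hasse-ridge-face-selection`, S3ρ sub-stub S3ρD `stub_wildMonicSurfaceDescent`:
# THE `s`-MAXIMAL CLEAN REPRESENTATIVE of a setting class (parent pipeline of Uk-ρD1: W-clean → s-attain → W-re-clean → s-clean)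

Crux item stmt-ResolutionOfSingularities-8899 `LocalWeightedDrop` (route `ResolutionOfSingularities/WeightedInvariant`), engine of
the door `HypersurfaceCentreConstruction` stmt-ResolutionOfSingularities-19897.  [OURS · L1 W4.3, chain w43, res-L1-w43-stub-7 (second
seat on S3ρ under res-type-083); Uk-ρD1 pipeline (STATUS 2026-08-27T09:01Z (6)), replacing Perlega's «we may assume `f` clean for finitely
many weights and secondary clean» (arXiv:2011.14443 Ch. 9 p0105) by: res-L1-w43-stub-3's ATTAINMENT of `s` in the setting class
(`exists_isGreatest_sFlag_shift`, p515426) + `w`-cleaning under UPPER BOUNDS (this file: inside a class whose three `m_w` are maximal the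
cleaning process terminates, keeps the class and does not lower `s`) + the finite secondary cleaning process (`exists_shift_isSClean`,
p516193).  Nothing here is a statement of H. Hironaka's manuscript [claim: Hironaka2017, status: under-review]; OUR objects.]

* `weightedOrder_le_mul_weightedOrder_one`, `wMin_le_mul_wMin_one` — `m_ν ≤ (ν₀+ν₁)·m_{(1,1)}`;
* `exists_cleanSeqS_stop_of_upper` — if `m_{(1,1)}` is bounded along all re-centrings of `B` (and finite), the `ν`-cleaning process STOPS
  at a `ν`-CLEAN stage (never at the zero tuple);
* `cleanSeqS_setting_of_upper` — if moreover the three setting weights are maximal at `B` among its re-centrings, every stage keeps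
  `(δ, r)` and `s` does not drop;
* `exists_shift_isWClean_list_of_upper` — hence simultaneous cleanness for a list of weights INSIDE the class, `s` not lowered;
* `exists_sMax_clean_rep` — THE `s`-MAXIMAL CLEAN REPRESENTATIVE: from a `(1,1)`/`(1,0)`/`(0,1)`-clean representative `shift d A g_W` with
  finite positive `δ₀`, either some member of its setting class has `sFlag = ⊤`, or some member is clean for every weight of a given list
  (containing the three setting weights), SECONDARY CLEAN, and `s`-MAXIMAL in the class with finite `s`.
-/

set_option linter.dupNamespace false -- mandated namespace of this single-conjunct summit

noncomputable section

namespace Summit.ResolutionOfSingularities.ResolutionOfSingularities.Theorems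

namespace WildMonic

open MvPowerSeries MonicDescent

variable {k : Type} [Field k] (p : ℕ) [Fact p.Prime] [CharP k p] {d : ℕ}

/-! ## `m_ν ≤ c·m_{(1,1)}` -/

omit [Fact p.Prime] [CharP k p] in
/-- `ord_ν F ≤ (ν₀ + ν₁)·ord_{(1,1)} F` for `F ≠ 0`. -/
theorem weightedOrder_le_mul_weightedOrder_one (ν : Fin 2 → ℕ) {F : MvPowerSeries (Fin 2) k} (hF : F ≠ 0) :
    F.weightedOrder ν ≤ ((ν 0 + ν 1 : ℕ) : ℕ∞) * F.weightedOrder ![1, 1] := by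
  obtain ⟨e, he, hwe⟩ := exists_coeff_ne_zero_and_weightedOrder ![1, 1] (f := F)
    (ENat.coe_toNat (by rwa [Ne, weightedOrder_eq_top_iff]))
  rw [← hwe]
  refine (weightedOrder_le ν he).trans ?_
  have h : Finsupp.weight ν e ≤ (ν 0 + ν 1) * Finsupp.weight ![1, 1] e := by
    rw [weight_fin_two, Literature.AlgebraicGeometry.Resolution.WeightedShear.weight_fin_two]
    nlinarith [Nat.zero_le (ν 0 * e 1), Nat.zero_le (ν 1 * e 0)]
  exact_mod_cast h

omit [Fact p.Prime] [CharP k p] in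
/-- Hence `m_ν(B) ≤ (ν₀ + ν₁)·m_{(1,1)}(B)` for `ν ≠ 0`. -/
theorem wMin_le_mul_wMin_one (ν : Fin 2 → ℕ) (hν : 0 < ν 0 + ν 1) (B : Fin d → MvPowerSeries (Fin 2) k) :
    wMin ν B ≤ ((ν 0 + ν 1 : ℕ) : ℕ∞) * wMin ![1, 1] B := by
  have hc : (((ν 0 + ν 1 : ℕ)) : ℕ∞) ≠ 0 := by exact_mod_cast hν.ne'
  rcases Nat.eq_zero_or_pos d with hd | hd
  · subst hd
    have h1 : wMin ![1, 1] B = ⊤ := by unfold wMin; exact iInf_of_empty _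
    rw [h1, ENat.mul_top hc]; exact le_top
  obtain ⟨i, hi⟩ := exists_slotWOrd_eq_wMin ![1, 1] B hd
  refine (wMin_le_slotWOrd ν B i).trans ?_
  rw [← hi]
  unfold slotWOrd
  by_cases hBi : B i = 0
  · rw [hBi, weightedOrder_zero, weightedOrder_zero, ENat.mul_top (by exact_mod_cast (slotWeight_pos i).ne'), ENat.mul_top hc]
  rw [mul_left_comm]
  gcongr
  exact weightedOrder_le_mul_weightedOrder_one ν hBi

/-! ## Cleaning under upper bounds -/

section Upper

variable [PerfectRing k p] (ν : Fin 2 → ℕ) (B : Fin d → MvPowerSeries (Fin 2) k) (hd : 0 < d) (hB : ∀ j, constantCoeff (B j) = 0)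
  (hfin : wMin ![1, 1] B ≠ ⊤) (hub11 : ∀ g : MvPowerSeries (Fin 2) k, constantCoeff g = 0 → wMin ![1, 1] (shift d B g) ≤ wMin ![1, 1] B)

include hB hfin hub11 in
/-- UNDER AN UPPER BOUND FOR `m_{(1,1)}` along all re-centrings, the `ν`-cleaning process STOPS, at a `ν`-CLEAN stage with finite `m_{(1,1)}`. -/
theorem exists_cleanSeqS_stop_of_upper (hν : 0 < ν 0 + ν 1) :
    ∃ n : ℕ, IsWClean p ν (cleanSeqS p ν hd B n).1 ∧ wMin ![1, 1] (cleanSeqS p ν hd B n).1 ≠ ⊤ := by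
  set K : ℕ∞ := ((ν 0 + ν 1 : ℕ) : ℕ∞) * wMin ![1, 1] B with hK
  have hKfin : K ≠ ⊤ := WithTop.mul_ne_top (ENat.coe_ne_top _) hfin
  have hbound : ∀ n, wMin ν (cleanSeqS p ν hd B n).1 ≤ K := by
    intro n
    refine (wMin_le_mul_wMin_one ν hν _).trans ?_
    rw [hK]
    gcongr
    rw [(cleanSeqS_spec p ν B hd n).1]
    exact hub11 _ (cleanSeqS_spec p ν B hd n).2
  have hfin11 : ∀ n, wMin ![1, 1] (cleanSeqS p ν hd B n).1 ≠ ⊤ := by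
    intro n
    have hle : wMin ![1, 1] (cleanSeqS p ν hd B n).1 ≤ wMin ![1, 1] B := by
      rw [(cleanSeqS_spec p ν B hd n).1]; exact hub11 _ (cleanSeqS_spec p ν B hd n).2
    exact ne_top_of_le_ne_top hfin hle
  by_contra hnone
  push Not at hnone
  have hruns : ∀ n, RunsS p ν B hd n := fun n =>
    ⟨fun hcl => hfin11 n (hnone n hcl), ne_top_of_le_ne_top hKfin (hbound n)⟩
  obtain ⟨M, hM⟩ := ENat.ne_top_iff_exists.mp hKfin
  have h := (le_wMin_cleanSeqS p ν B hd hB (M + 1) fun i _ => hruns i).trans (hbound (M + 1))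
  rw [← hM] at h
  have h2 : ((M + 1 : ℕ) : ℕ∞) ≤ (M : ℕ∞) := le_trans le_add_self h
  exact absurd (by exact_mod_cast h2 : M + 1 ≤ M) (by omega)

variable (E : Finset (Fin 2))
  (hub10 : (0 : Fin 2) ∈ E → ∀ g : MvPowerSeries (Fin 2) k, constantCoeff g = 0 → wMin ![1, 0] (shift d B g) ≤ wMin ![1, 0] B)
  (hub01 : (1 : Fin 2) ∈ E → ∀ g : MvPowerSeries (Fin 2) k, constantCoeff g = 0 → wMin ![0, 1] (shift d B g) ≤ wMin ![0, 1] B)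

include hB hub11 hub10 hub01 in
/-- IF THE THREE SETTING WEIGHTS ARE MAXIMAL AT `B` among its re-centrings, every stage of the `ν`-cleaning process keeps them, hence keeps
`(δ, r)`, and `s` does not drop (Lemma 5.2.2 (1) with the support clause). -/
theorem cleanSeqS_setting_of_upper {s : ℕ} (hs : (s : ℕ∞) ≤ sFlag E (newtonSet B)) (n : ℕ) :
    excExp E (newtonSet (cleanSeqS p ν hd B n).1) = excExp E (newtonSet B) ∧
      dRes E (newtonSet (cleanSeqS p ν hd B n).1) = dRes E (newtonSet B) ∧ (s : ℕ∞) ≤ sFlag E (newtonSet (cleanSeqS p ν hd B n).1) := by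
  -- the three `m_w` are constant along the process
  have hconst : ∀ n, wMin ![1, 1] (cleanSeqS p ν hd B n).1 = wMin ![1, 1] B ∧
      ((0 : Fin 2) ∈ E → wMin ![1, 0] (cleanSeqS p ν hd B n).1 = wMin ![1, 0] B) ∧
      ((1 : Fin 2) ∈ E → wMin ![0, 1] (cleanSeqS p ν hd B n).1 = wMin ![0, 1] B) := by
    intro n
    have hsp := cleanSeqS_spec p ν B hd n
    refine ⟨le_antisymm ?_ (wMin_le_cleanSeqS_all p ν B hd hB _ n), fun h0 => le_antisymm ?_ (wMin_le_cleanSeqS_all p ν B hd hB _ n),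
      fun h1 => le_antisymm ?_ (wMin_le_cleanSeqS_all p ν B hd hB _ n)⟩
    · rw [hsp.1]; exact hub11 _ hsp.2
    · rw [hsp.1]; exact hub10 h0 _ hsp.2
    · rw [hsp.1]; exact hub01 h1 _ hsp.2
  have hsetting : ∀ n, excExp E (newtonSet (cleanSeqS p ν hd B n).1) = excExp E (newtonSet B) ∧
      dRes E (newtonSet (cleanSeqS p ν hd B n).1) = dRes E (newtonSet B) := fun n =>
    ⟨excExp_eq_of_wMin_eq E (hconst n).2.1 (hconst n).2.2, dRes_eq_of_wMin_eq E (hconst n).2.1 (hconst n).2.2 (hconst n).1⟩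
  refine ⟨(hsetting n).1, (hsetting n).2, ?_⟩
  induction n with
  | zero => exact hs
  | succ n ih =>
    by_cases hr : RunsS p ν B hd n
    · obtain ⟨g, -, h1, -, -, -, hsupp⟩ := cleanSeqS_step p ν B hd hB hr
      have hr' : excExp E (newtonSet (shift d (cleanSeqS p ν hd B n).1 g)) = excExp E (newtonSet (cleanSeqS p ν hd B n).1) := by
        rw [← h1, (hsetting (n + 1)).1, (hsetting n).1]
      have hδ' : dRes E (newtonSet (shift d (cleanSeqS p ν hd B n).1 g)) = dRes E (newtonSet (cleanSeqS p ν hd B n).1) := by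
        rw [← h1, (hsetting (n + 1)).2, (hsetting n).2]
      rw [h1]
      exact natCast_le_sFlag_shift E E _ g ih hδ' hr' (theta_le_of_supp p _ hd hsupp E ih)
    · rw [cleanSeqS_succ_of_not_runs p ν B hd hr]; exact ih

end Upper

/-! ## Simultaneous cleanness inside the class -/

section UpperList

variable [PerfectRing k p] (E : Finset (Fin 2))

/-- SIMULTANEOUS CLEANNESS INSIDE A MAXIMAL SETTING CLASS: at a position `B` (`B_j(0) = 0`, finite `m_{(1,1)}`) whose three setting weights
are maximal among its re-centrings, one re-centring `g` (`g(0) = 0`) makes it clean for every weight of the list, keeps `(δ, r)`, does not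
lower `s`, and decreases no `m_w`. -/
theorem exists_shift_isWClean_list_of_upper (hd : 0 < d) :
    ∀ (ws : List (Fin 2 → ℕ)), (∀ w ∈ ws, 0 < w 0 + w 1) →
      ∀ (B : Fin d → MvPowerSeries (Fin 2) k), (∀ j, constantCoeff (B j) = 0) → wMin ![1, 1] B ≠ ⊤ →
      (∀ g : MvPowerSeries (Fin 2) k, constantCoeff g = 0 → wMin ![1, 1] (shift d B g) ≤ wMin ![1, 1] B) →
      ((0 : Fin 2) ∈ E → ∀ g : MvPowerSeries (Fin 2) k, constantCoeff g = 0 → wMin ![1, 0] (shift d B g) ≤ wMin ![1, 0] B) →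
      ((1 : Fin 2) ∈ E → ∀ g : MvPowerSeries (Fin 2) k, constantCoeff g = 0 → wMin ![0, 1] (shift d B g) ≤ wMin ![0, 1] B) →
      ∀ {s : ℕ}, (s : ℕ∞) ≤ sFlag E (newtonSet B) →
      ∃ g : MvPowerSeries (Fin 2) k, constantCoeff g = 0 ∧ (∀ w ∈ ws, IsWClean p w (shift d B g)) ∧
        (∀ w' : Fin 2 → ℕ, wMin w' B ≤ wMin w' (shift d B g)) ∧
        excExp E (newtonSet (shift d B g)) = excExp E (newtonSet B) ∧ dRes E (newtonSet (shift d B g)) = dRes E (newtonSet B) ∧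
        (s : ℕ∞) ≤ sFlag E (newtonSet (shift d B g)) := by
  intro ws
  induction ws with
  | nil =>
    intro _ B hB hfin hub11 hub10 hub01 s hs
    exact ⟨0, map_zero _, fun w hw => by simp at hw, fun w' => by rw [shift_zero], by rw [shift_zero], by rw [shift_zero],
      by rw [shift_zero]; exact hs⟩
  | cons ν ws ih =>
    intro hws0 B hB hfin hub11 hub10 hub01 s hs
    obtain ⟨g₁, hg₁0, hws, hmono₁, hr₁, hδ₁, hs₁⟩ :=
      ih (fun w hw => hws0 w (List.mem_cons_of_mem _ hw)) B hB hfin hub11 hub10 hub01 hs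
    -- the hypotheses pass to `B₁ = shift d B g₁` (same class: its three `m_w` equal those of `B`)
    have hB₁ : ∀ j, constantCoeff (shift d B g₁ j) = 0 := constantCoeff_shift B hB hg₁0
    have h11eq : wMin ![1, 1] (shift d B g₁) = wMin ![1, 1] B := le_antisymm (hub11 _ hg₁0) (hmono₁ _)
    have hfin₁ : wMin ![1, 1] (shift d B g₁) ≠ ⊤ := by rw [h11eq]; exact hfin
    have hub11₁ : ∀ g : MvPowerSeries (Fin 2) k, constantCoeff g = 0 →
        wMin ![1, 1] (shift d (shift d B g₁) g) ≤ wMin ![1, 1] (shift d B g₁) := fun g hg => by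
      rw [shift_shift, h11eq]; exact hub11 _ (by rw [map_add, hg, hg₁0, add_zero])
    have hub10₁ : (0 : Fin 2) ∈ E → ∀ g : MvPowerSeries (Fin 2) k, constantCoeff g = 0 →
        wMin ![1, 0] (shift d (shift d B g₁) g) ≤ wMin ![1, 0] (shift d B g₁) := fun h0 g hg => by
      rw [shift_shift]
      exact (hub10 h0 _ (by rw [map_add, hg, hg₁0, add_zero])).trans (hmono₁ _)
    have hub01₁ : (1 : Fin 2) ∈ E → ∀ g : MvPowerSeries (Fin 2) k, constantCoeff g = 0 →
        wMin ![0, 1] (shift d (shift d B g₁) g) ≤ wMin ![0, 1] (shift d B g₁) := fun h1 g hg => by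
      rw [shift_shift]
      exact (hub01 h1 _ (by rw [map_add, hg, hg₁0, add_zero])).trans (hmono₁ _)
    -- clean for `ν` from `B₁`
    have hν : 0 < ν 0 + ν 1 := hws0 ν (by simp)
    obtain ⟨n, hνn, hfinn⟩ := exists_cleanSeqS_stop_of_upper p ν (shift d B g₁) hd hB₁ hfin₁ hub11₁ hν
    obtain ⟨hrn, hδn, hsn⟩ := cleanSeqS_setting_of_upper p ν (shift d B g₁) hd hB₁ hub11₁ E hub10₁ hub01₁ hs₁ n
    have hspec := cleanSeqS_spec p ν (shift d B g₁) hd n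
    have hB₁ne : shift d B g₁ ≠ 0 := fun h0 => by
      apply hfin₁
      rw [h0]
      unfold wMin slotWOrd
      simp only [Pi.zero_apply, weightedOrder_zero]
      rw [iInf_eq_top]
      intro i
      exact ENat.mul_top (by exact_mod_cast (slotWeight_pos i).ne')
    refine ⟨(cleanSeqS p ν hd (shift d B g₁) n).2 + g₁, by rw [map_add, hspec.2, hg₁0, add_zero], ?_, ?_, ?_, ?_, ?_⟩
    · intro w hw
      rw [← shift_shift, ← hspec.1]
      rcases List.mem_cons.1 hw with rfl | hmem
      · exact hνn
      · exact (cleanSeqS_preserve p ν (shift d B g₁) hd hB₁ w (hws w hmem) (wMin_ne_top_of_ne_zero w hB₁ne) n).1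
    · intro w'
      rw [← shift_shift, ← hspec.1]
      exact (hmono₁ w').trans (wMin_le_cleanSeqS_all p ν (shift d B g₁) hd hB₁ w' n)
    · rw [← shift_shift, ← hspec.1, hrn, hr₁]
    · rw [← shift_shift, ← hspec.1, hδn, hδ₁]
    · rw [← shift_shift, ← hspec.1]; exact hsn

end UpperList

/-! ## The `s`-maximal clean representative -/

section SMax

variable [PerfectRing k p]

/-- Inside the setting class of a representative whose three setting weights are maximal, the maximality hypothesis of
res-L1-w43-stub-3's attainment theorem holds: a re-centring that dominates `(δ₀, r₀)` has exactly `(δ₀, r₀)`. -/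
theorem setting_eq_of_dominates (E : Finset (Fin 2)) (A : Fin d → MvPowerSeries (Fin 2) k) {g₀ : MvPowerSeries (Fin 2) k}
    (hnz : ∀ g : MvPowerSeries (Fin 2) k, constantCoeff g = 0 → (newtonSet (shift d A g)).Nonempty) (hg₀ : constantCoeff g₀ = 0)
    (hub11 : ∀ g : MvPowerSeries (Fin 2) k, constantCoeff g = 0 → wMin ![1, 1] (shift d A g) ≤ wMin ![1, 1] (shift d A g₀))
    (hub10 : (0 : Fin 2) ∈ E → ∀ g : MvPowerSeries (Fin 2) k, constantCoeff g = 0 → wMin ![1, 0] (shift d A g) ≤ wMin ![1, 0] (shift d A g₀))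
    (hub01 : (1 : Fin 2) ∈ E → ∀ g : MvPowerSeries (Fin 2) k, constantCoeff g = 0 → wMin ![0, 1] (shift d A g) ≤ wMin ![0, 1] (shift d A g₀))
    (g : MvPowerSeries (Fin 2) k) (hg : constantCoeff g = 0)
    (hr : ∀ i ∈ E, excExp E (newtonSet (shift d A g₀)) i ≤ excExp E (newtonSet (shift d A g)) i)
    (hδ : dRes E (newtonSet (shift d A g₀)) + excExp E (newtonSet (shift d A g₀)) 0 + excExp E (newtonSet (shift d A g₀)) 1 ≤
      dRes E (newtonSet (shift d A g)) + excExp E (newtonSet (shift d A g)) 0 + excExp E (newtonSet (shift d A g)) 1) :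
    dRes E (newtonSet (shift d A g)) = dRes E (newtonSet (shift d A g₀)) ∧
      excExp E (newtonSet (shift d A g)) = excExp E (newtonSet (shift d A g₀)) := by
  obtain ⟨h11X, h10X, h01X⟩ := wMin_eq_of_newtonSet_nonempty E (shift d A g) (hnz g hg)
  obtain ⟨h11B, h10B, h01B⟩ := wMin_eq_of_newtonSet_nonempty E (shift d A g₀) (hnz g₀ hg₀)
  have hsum : dRes E (newtonSet (shift d A g)) + excExp E (newtonSet (shift d A g)) 0 + excExp E (newtonSet (shift d A g)) 1 ≤
      dRes E (newtonSet (shift d A g₀)) + excExp E (newtonSet (shift d A g₀)) 0 + excExp E (newtonSet (shift d A g₀)) 1 := by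
    have h := hub11 g hg
    rw [h11X, h11B] at h
    exact_mod_cast h
  have hr0 : excExp E (newtonSet (shift d A g)) 0 = excExp E (newtonSet (shift d A g₀)) 0 := by
    by_cases h0 : (0 : Fin 2) ∈ E
    · refine le_antisymm ?_ (hr 0 h0)
      have h := hub10 h0 g hg
      rw [h10X h0, h10B h0] at h
      exact_mod_cast h
    · rw [excExp_apply_zero, excExp_apply_zero, if_neg h0, if_neg h0]
  have hr1 : excExp E (newtonSet (shift d A g)) 1 = excExp E (newtonSet (shift d A g₀)) 1 := by
    by_cases h1 : (1 : Fin 2) ∈ E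
    · refine le_antisymm ?_ (hr 1 h1)
      have h := hub01 h1 g hg
      rw [h01X h1, h01B h1] at h
      exact_mod_cast h
    · rw [excExp_apply_one, excExp_apply_one, if_neg h1, if_neg h1]
  refine ⟨by omega, ?_⟩
  ext i
  fin_cases i
  · exact hr0
  · exact hr1

/-- THE `s`-MAXIMAL CLEAN REPRESENTATIVE (parent pipeline of Uk-ρD1: W-clean ↦ s-attain ↦ W-re-clean ↦ s-clean).  From a representative
`shift d A g₀` that is clean for every weight of a list `ws ∋ (1,1)` (and `∋ (1,0)` if `0 ∈ E`, `∋ (0,1)` if `1 ∈ E`), with `δ > 0`, at a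
position none of whose re-centrings is annihilated: EITHER some member of its setting class has `sFlag = ⊤`, OR some member is clean for every
weight of `ws`, SECONDARY CLEAN, with finite `s` MAXIMAL over the class. -/
theorem exists_sMax_clean_rep (hd : 0 < d) (E : Finset (Fin 2)) (A : Fin d → MvPowerSeries (Fin 2) k) (hA : ∀ j, constantCoeff (A j) = 0)
    (hnz : ∀ g : MvPowerSeries (Fin 2) k, constantCoeff g = 0 → (newtonSet (shift d A g)).Nonempty)
    (ws : List (Fin 2 → ℕ)) (hws0 : ∀ w ∈ ws, 0 < w 0 + w 1) (h11 : (![1, 1] : Fin 2 → ℕ) ∈ ws)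
    (h10 : (0 : Fin 2) ∈ E → (![1, 0] : Fin 2 → ℕ) ∈ ws) (h01 : (1 : Fin 2) ∈ E → (![0, 1] : Fin 2 → ℕ) ∈ ws)
    {g₀ : MvPowerSeries (Fin 2) k} (hg₀ : constantCoeff g₀ = 0) (hclean₀ : ∀ w ∈ ws, IsWClean p w (shift d A g₀))
    (hδ₀ : 0 < dRes E (newtonSet (shift d A g₀))) :
    (∃ g : MvPowerSeries (Fin 2) k, constantCoeff g = 0 ∧ excExp E (newtonSet (shift d A g)) = excExp E (newtonSet (shift d A g₀)) ∧
        dRes E (newtonSet (shift d A g)) = dRes E (newtonSet (shift d A g₀)) ∧ sFlag E (newtonSet (shift d A g)) = ⊤) ∨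
    ∃ (g : MvPowerSeries (Fin 2) k) (s : ℕ), constantCoeff g = 0 ∧
      excExp E (newtonSet (shift d A g)) = excExp E (newtonSet (shift d A g₀)) ∧
      dRes E (newtonSet (shift d A g)) = dRes E (newtonSet (shift d A g₀)) ∧
      (∀ w ∈ ws, IsWClean p w (shift d A g)) ∧ IsSClean p E (shift d A g) ∧ sFlag E (newtonSet (shift d A g)) = s ∧
      ∀ g' : MvPowerSeries (Fin 2) k, constantCoeff g' = 0 →
        excExp E (newtonSet (shift d A g')) = excExp E (newtonSet (shift d A g₀)) →
        dRes E (newtonSet (shift d A g')) = dRes E (newtonSet (shift d A g₀)) → sFlag E (newtonSet (shift d A g')) ≤ s := by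
  have hempty : newtonSet (0 : Fin d → MvPowerSeries (Fin 2) k) = ∅ := (newtonSet_eq_empty_iff _).2 fun _ => rfl
  have hne0 : shift d A g₀ ≠ 0 := fun h => by
    have hN := hnz g₀ hg₀
    rw [h, hempty] at hN
    exact Set.not_nonempty_empty hN
  -- the three setting weights are maximal at the clean representative
  have hub11 : ∀ g : MvPowerSeries (Fin 2) k, constantCoeff g = 0 → wMin ![1, 1] (shift d A g) ≤ wMin ![1, 1] (shift d A g₀) :=
    fun g _ => wMin_shift_le_of_isWClean_shift p _ A (hclean₀ _ h11) (wMin_ne_top_of_ne_zero _ hne0) g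
  have hub10 : (0 : Fin 2) ∈ E → ∀ g : MvPowerSeries (Fin 2) k, constantCoeff g = 0 →
      wMin ![1, 0] (shift d A g) ≤ wMin ![1, 0] (shift d A g₀) :=
    fun h0 g _ => wMin_shift_le_of_isWClean_shift p _ A (hclean₀ _ (h10 h0)) (wMin_ne_top_of_ne_zero _ hne0) g
  have hub01 : (1 : Fin 2) ∈ E → ∀ g : MvPowerSeries (Fin 2) k, constantCoeff g = 0 →
      wMin ![0, 1] (shift d A g) ≤ wMin ![0, 1] (shift d A g₀) :=
    fun h1 g _ => wMin_shift_le_of_isWClean_shift p _ A (hclean₀ _ (h01 h1)) (wMin_ne_top_of_ne_zero _ hne0) g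
  by_cases hfin : ∀ g : MvPowerSeries (Fin 2) k, constantCoeff g = 0 →
      dRes E (newtonSet (shift d A g)) = dRes E (newtonSet (shift d A g₀)) →
      excExp E (newtonSet (shift d A g)) = excExp E (newtonSet (shift d A g₀)) → sFlag E (newtonSet (shift d A g)) ≠ ⊤
  swap
  · left
    simp only [not_forall, exists_prop, not_not] at hfin
    obtain ⟨g, hg, hδ, hr, htop⟩ := hfin
    exact ⟨g, hg, hr, hδ, htop⟩
  right
  -- s-ATTAIN (res-L1-w43-stub-3, p515426)
  obtain ⟨g₁, hg₁0, hδ₁, hr₁, hs₁fin, hmax₁⟩ := exists_isGreatest_sFlag_shift hd E A _ hδ₀ _ hnz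
    (fun g hg hr hδ => setting_eq_of_dominates E A hnz hg₀ hub11 hub10 hub01 g hg hr hδ) ⟨g₀, hg₀, rfl, rfl⟩ hfin
  obtain ⟨s, hs⟩ := ENat.ne_top_iff_exists.mp hs₁fin
  -- the class has constant setting weights
  have hwB : ∀ {g : MvPowerSeries (Fin 2) k}, constantCoeff g = 0 →
      dRes E (newtonSet (shift d A g)) = dRes E (newtonSet (shift d A g₀)) →
      excExp E (newtonSet (shift d A g)) = excExp E (newtonSet (shift d A g₀)) →
      wMin ![1, 1] (shift d A g) = wMin ![1, 1] (shift d A g₀) ∧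
        ((0 : Fin 2) ∈ E → wMin ![1, 0] (shift d A g) = wMin ![1, 0] (shift d A g₀)) ∧
        ((1 : Fin 2) ∈ E → wMin ![0, 1] (shift d A g) = wMin ![0, 1] (shift d A g₀)) := by
    intro g hg hδ hr
    obtain ⟨a1, a2, a3⟩ := wMin_eq_of_newtonSet_nonempty E (shift d A g) (hnz g hg)
    obtain ⟨b1, b2, b3⟩ := wMin_eq_of_newtonSet_nonempty E (shift d A g₀) (hnz g₀ hg₀)
    refine ⟨by rw [a1, b1, hδ, hr], fun h0 => by rw [a2 h0, b2 h0, hr], fun h1 => by rw [a3 h1, b3 h1, hr]⟩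
  obtain ⟨h11₁, h10₁, h01₁⟩ := hwB hg₁0 hδ₁ hr₁
  have hB₁ : ∀ j, constantCoeff (shift d A g₁ j) = 0 := constantCoeff_shift A hA hg₁0
  have hne₁ : shift d A g₁ ≠ 0 := fun h => by
    have hN := hnz g₁ hg₁0
    rw [h, hempty] at hN
    exact Set.not_nonempty_empty hN
  -- W-RE-CLEAN inside the class (does not lower `s`)
  obtain ⟨g₂, hg₂0, hws₂, -, hr₂, hδ₂, hs₂⟩ := exists_shift_isWClean_list_of_upper p E hd ws hws0 (shift d A g₁) hB₁
    (wMin_ne_top_of_ne_zero _ hne₁)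
    (fun g hg => by rw [shift_shift, h11₁]; exact hub11 _ (by rw [map_add, hg, hg₁0, add_zero]))
    (fun h0 g hg => by rw [shift_shift, h10₁ h0]; exact hub10 h0 _ (by rw [map_add, hg, hg₁0, add_zero]))
    (fun h1 g hg => by rw [shift_shift, h01₁ h1]; exact hub01 h1 _ (by rw [map_add, hg, hg₁0, add_zero]))
    (s := s) (by rw [hs])
  rw [shift_shift] at hws₂ hr₂ hδ₂ hs₂
  have hg₂₁ : constantCoeff (g₂ + g₁) = 0 := by rw [map_add, hg₂0, hg₁0, add_zero]
  have hsB₂ : sFlag E (newtonSet (shift d A (g₂ + g₁))) = s :=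
    le_antisymm (by rw [hs]; exact hmax₁ _ hg₂₁ (hδ₂.trans hδ₁) (hr₂.trans hr₁)) hs₂
  -- s-CLEAN at the `s`-maximal, clean member (p516193)
  obtain ⟨g₃, hg₃0, hkeep₃, -, hr₃, hδ₃, hs₃, hclean₃⟩ := exists_shift_isSClean p E hd (shift d A (g₂ + g₁)) hsB₂
    (hws₂ _ h11) (fun h0 => hws₂ _ (h10 h0)) (fun h1 => hws₂ _ (h01 h1))
    (fun g hg hrg hδg => by
      rw [shift_shift] at hrg hδg ⊢
      rw [hs]
      exact hmax₁ _ (by rw [map_add, hg, hg₂₁, add_zero]) ((hδg.trans hδ₂).trans hδ₁) ((hrg.trans hr₂).trans hr₁))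
  rw [shift_shift] at hkeep₃ hr₃ hδ₃ hs₃ hclean₃
  refine ⟨g₃ + (g₂ + g₁), s, by rw [map_add, hg₃0, hg₂₁, add_zero], (hr₃.trans hr₂).trans hr₁, (hδ₃.trans hδ₂).trans hδ₁,
    fun w hw => (hkeep₃ w (hws₂ w hw)).1, hclean₃, hs₃, fun g' hg' hr' hδ' => ?_⟩
  rw [hs]
  exact hmax₁ g' hg' hδ' hr'

end SMax

end WildMonic

end Summit.ResolutionOfSingularities.ResolutionOfSingularities.Theorems

end
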